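import Summits.HubbardSuperconductivity.HubbardLadder.DWaveFormFactorSum
import Mathlib.Analysis.SpecialFunctions.Integrals.Basic
import Mathlib.MeasureTheory.Integral.IntervalIntegral.Periodic
import HarnessLib

/-!
# The `d`-wave form-factor sum, all `L`: `Φ_L = Σ_k |cos k₁ - cos k₂| ≤ 8L²/π² + 8L/π`

pub-hubbard r3 — rung 0′ of the R4 ceiling ladder (R4-MEMO §9.10). HONEST FRAMING: ladder R1–R4
with certified numbers; no claim on H/H₀. NEW cell-side mathematics (not a published result), staged
by the r3 planner seat for a prover/librarian seat. Part 3b of 5 (imports `DWaveFormFactorSum`).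

* `integral_abs_sin_zero_two_pi`, `integral_abs_sin_period`: `∫ over a period of |sin| = 4`;
* **`sum_abs_sin_mul_sin_le`** (total variation): `(Σ_{a<L} |sin(2πa/L - θ)|)·sin(π/L) ≤ 2` for every
  real `θ` (`2 sin(π/L)|sin x| = |cos(x-π/L) - cos(x+π/L)| ≤ ∫_{x-π/L}^{x+π/L} |sin|`, adjacent
  intervals tile one period);
* `one_le_mul_sin_pi_div`: `csc(π/L) ≤ L/π + 1` (`L ≥ 2`);
* **`sum_absSinZMod_two_mul_sub_le`**: `Σ_{a ∈ ℤ/Lℤ} g(2a - s) ≤ 2L/π + 2` for every `s`;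
* **`sum_abs_dWaveGap_le_uniform`**: `Φ_L ≤ 8L²/π² + 8L/π` for EVERY `L ≥ 1` (fix `a`, reindex
  `b ↦ a + b`, swap the sums). The odd-`L` value `8L²/π²` of `DWaveFormFactorSum` is sharper by the
  `8L/π` term; both give `Φ_L/L² → 8/π² = (2π)⁻² ∫∫ |cos x - cos y|`.
-/

namespace Summit.HubbardSuperconductivity.HubbardLadder

open Finset Literature.Probability.LatticeModels Literature.MathematicalPhysics.QuantumLattice

variable {L : ℕ} [NeZero L]

/-! ### A uniform bound for every `L`: `Φ_L ≤ 8L²/π² + 8L/π`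

For each fixed `a`, `b ↦ s = a + b` is a bijection, so `Φ_L = 2 Σ_s g(s) Σ_a g(2a - s)`; the inner
sum is a Riemann-type sum `Σ_{a<L} |sin(2πa/L - θ)|`, bounded through the total variation of `cos`
over one period: `2 sin(π/L) |sin x| = |cos(x - π/L) - cos(x + π/L)| ≤ ∫_{x-π/L}^{x+π/L} |sin|`, and
`∫ over a period of |sin| = 4`. -/

/-- `∫_0^{2π} |sin t| dt = 4`. [folklore] -/
theorem integral_abs_sin_zero_two_pi : ∫ t in (0 : ℝ)..2 * Real.pi, |Real.sin t| = 4 := by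
  have h1 : ∫ t in (0 : ℝ)..Real.pi, |Real.sin t| = 2 := by
    rw [intervalIntegral.integral_congr (g := Real.sin) ?_]
    · rw [integral_sin, Real.cos_zero, Real.cos_pi]; norm_num
    · intro t ht
      rw [Set.uIcc_of_le Real.pi_pos.le] at ht
      exact abs_of_nonneg (Real.sin_nonneg_of_nonneg_of_le_pi ht.1 ht.2)
  have h2 : ∫ t in Real.pi..2 * Real.pi, |Real.sin t| = 2 := by
    rw [intervalIntegral.integral_congr (g := fun t => -Real.sin t) ?_]
    · rw [intervalIntegral.integral_neg, integral_sin, Real.cos_pi, Real.cos_two_pi]; norm_num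
    · intro t ht
      rw [Set.uIcc_of_le (by linarith [Real.pi_pos])] at ht
      have ht' : 0 ≤ Real.sin (t - Real.pi) :=
        Real.sin_nonneg_of_nonneg_of_le_pi (by linarith [ht.1]) (by linarith [ht.2])
      rw [Real.sin_sub_pi] at ht'
      exact abs_of_nonpos (by linarith)
  rw [← intervalIntegral.integral_add_adjacent_intervals (b := Real.pi)
    (Real.continuous_sin.abs.intervalIntegrable _ _)
    (Real.continuous_sin.abs.intervalIntegrable _ _), h1, h2]
  norm_num

/-- `∫_y^{y+2π} |sin t| dt = 4` for every `y` (periodicity). [folklore] -/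
theorem integral_abs_sin_period (y : ℝ) : ∫ t in y..y + 2 * Real.pi, |Real.sin t| = 4 := by
  have hp : Function.Periodic (fun t => |Real.sin t|) (2 * Real.pi) :=
    fun t => congrArg abs (Real.sin_periodic t)
  rw [hp.intervalIntegral_add_eq y 0, zero_add, integral_abs_sin_zero_two_pi]

/-- **Total-variation bound**: `(Σ_{a<L} |sin(2πa/L - θ)|) · sin(π/L) ≤ 2` for every real `θ`.
[folklore] -/
theorem sum_abs_sin_mul_sin_le (L : ℕ) (hL : L ≠ 0) (θ : ℝ) :
    (∑ a ∈ range L, |Real.sin (2 * Real.pi * a / L - θ)|) * Real.sin (Real.pi / L) ≤ 2 := by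
  have hL' : (0 : ℝ) < L := by exact_mod_cast Nat.pos_of_ne_zero hL
  have hL1 : (1 : ℝ) ≤ L := by exact_mod_cast Nat.one_le_iff_ne_zero.2 hL
  have hpi := Real.pi_pos
  set y : ℕ → ℝ := fun j => 2 * Real.pi * j / L - θ - Real.pi / L with hy
  have hsinL : 0 ≤ Real.sin (Real.pi / L) :=
    Real.sin_nonneg_of_nonneg_of_le_pi (by positivity) (div_le_self hpi.le hL1)
  have hpt : ∀ a : ℕ, |Real.sin (2 * Real.pi * a / L - θ)| * Real.sin (Real.pi / L) =
      |Real.cos (y a) - Real.cos (y (a + 1))| / 2 := by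
    intro a
    rw [Real.cos_sub_cos]
    have e1 : (y a + y (a + 1)) / 2 = 2 * Real.pi * a / L - θ := by
      simp only [hy]; push_cast; field_simp; ring
    have e2 : (y a - y (a + 1)) / 2 = -(Real.pi / L) := by
      simp only [hy]; push_cast; field_simp; ring
    rw [e1, e2, Real.sin_neg, abs_mul, abs_mul, abs_neg, abs_two, abs_neg, abs_of_nonneg hsinL]
    ring
  have hint : ∀ a : ℕ, |Real.cos (y a) - Real.cos (y (a + 1))| ≤
      ∫ t in y a..y (a + 1), |Real.sin t| := by
    intro a
    have hle : y a ≤ y (a + 1) := by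
      have : 2 * Real.pi * (a : ℝ) / L ≤ 2 * Real.pi * ((a : ℝ) + 1) / L := by
        gcongr; linarith
      simp only [hy]; push_cast; linarith
    rw [← integral_sin]
    exact intervalIntegral.abs_integral_le_integral_abs hle
  have hadj : ∑ a ∈ range L, ∫ t in y a..y (a + 1), |Real.sin t| =
      ∫ t in y 0..y L, |Real.sin t| :=
    intervalIntegral.sum_integral_adjacent_intervals fun k _ =>
      Real.continuous_sin.abs.intervalIntegrable _ _
  have hper : y L = y 0 + 2 * Real.pi := by
    simp only [hy]; push_cast; field_simp; ring
  calc (∑ a ∈ range L, |Real.sin (2 * Real.pi * a / L - θ)|) * Real.sin (Real.pi / L)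
      = ∑ a ∈ range L, |Real.cos (y a) - Real.cos (y (a + 1))| / 2 := by
        rw [Finset.sum_mul]; exact Finset.sum_congr rfl fun a _ => hpt a
    _ ≤ ∑ a ∈ range L, (∫ t in y a..y (a + 1), |Real.sin t|) / 2 := by
        gcongr with a _; exact hint a
    _ = (∫ t in y 0..y L, |Real.sin t|) / 2 := by rw [← Finset.sum_div, hadj]
    _ = 2 := by rw [hper, integral_abs_sin_period]; norm_num

/-- `csc(π/L) ≤ L/π + 1` for `L ≥ 2`, in the form `1 ≤ (L/π + 1) sin(π/L)`
(`csc x - cot x = tan(x/2) ≤ 1` and `cot x ≤ 1/x` on `(0, π/2]`). [folklore] -/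
theorem one_le_mul_sin_pi_div (L : ℕ) (hL : 2 ≤ L) :
    1 ≤ ((L : ℝ) / Real.pi + 1) * Real.sin (Real.pi / L) := by
  have hpi := Real.pi_pos
  have hL' : (2 : ℝ) ≤ L := by exact_mod_cast hL
  have hLpos : (0 : ℝ) < L := by linarith
  set x : ℝ := Real.pi / L with hx
  have hx0 : 0 < x := by positivity
  have hxle : x ≤ Real.pi / 2 := by
    rw [hx]; exact div_le_div_of_nonneg_left hpi.le (by norm_num) hL'
  have hs : 0 ≤ Real.sin x := Real.sin_nonneg_of_nonneg_of_le_pi hx0.le (by linarith)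
  have hc : 0 ≤ Real.cos x := Real.cos_nonneg_of_mem_Icc ⟨by linarith, hxle⟩
  have h1 : 1 ≤ Real.sin x + Real.cos x := by
    nlinarith [Real.sin_sq_add_cos_sq x, hs, hc]
  have h2 : x * Real.cos x ≤ Real.sin x := by
    rcases lt_or_eq_of_le hxle with hlt | heq
    · have ht := Real.le_tan hx0.le hlt
      have hcpos : 0 < Real.cos x := Real.cos_pos_of_mem_Ioo ⟨by linarith, hlt⟩
      rw [Real.tan_eq_sin_div_cos, le_div_iff₀ hcpos] at ht
      linarith
    · rw [heq, Real.cos_pi_div_two, mul_zero]; rw [heq] at hs; exact hs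
  have hLx : (L : ℝ) / Real.pi = 1 / x := by
    rw [hx]; field_simp
  rw [hLx]
  have key : x ≤ Real.sin x + x * Real.sin x := by nlinarith [h1, h2, hx0, hs, hc]
  rw [show (1 / x + 1) * Real.sin x = (Real.sin x + x * Real.sin x) / x by field_simp]
  rw [le_div_iff₀ hx0]
  linarith

/-- `(2a-s).val ≡ 2·a.val - s.val (mod L)`. -/
private theorem dvd_val_two_mul_sub (a s : ZMod L) :
    (L : ℤ) ∣ ((2 * a - s).val : ℤ) - (2 * (a.val : ℤ) - s.val) := by
  rw [← ZMod.intCast_zmod_eq_zero_iff_dvd]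
  push_cast
  rw [ZMod.natCast_zmod_val, ZMod.natCast_zmod_val, ZMod.natCast_zmod_val, sub_self]

/-- **KEY**: `Σ_{a ∈ ℤ/Lℤ} g(2a - s) ≤ 2L/π + 2` for every `s` and every `L ≥ 1`. [folklore] -/
theorem sum_absSinZMod_two_mul_sub_le (s : ZMod L) :
    ∑ a : ZMod L, absSinZMod (2 * a - s) ≤ 2 * L / Real.pi + 2 := by
  have hL : (L : ℕ) ≠ 0 := NeZero.ne L
  have hpi := Real.pi_pos
  have hcong : ∀ a : ZMod L, absSinZMod (2 * a - s) = absSinZ L (2 * (a.val : ℤ) - s.val) :=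
    fun a => absSinZ_eq_of_dvd hL (dvd_val_two_mul_sub a s)
  have h1 : ∑ a : ZMod L, absSinZMod (2 * a - s) =
      ∑ n ∈ (univ : Finset (ZMod L)).image ZMod.val, absSinZ L (2 * (n : ℤ) - s.val) := by
    rw [Finset.sum_image fun a _ b _ h => ZMod.val_injective L h]
    exact Finset.sum_congr rfl fun a _ => hcong a
  have h2 : ∑ n ∈ (univ : Finset (ZMod L)).image ZMod.val, absSinZ L (2 * (n : ℤ) - s.val) ≤
      ∑ n ∈ range L, absSinZ L (2 * (n : ℤ) - s.val) := by
    refine Finset.sum_le_sum_of_subset_of_nonneg ?_ fun n _ _ => absSinZ_nonneg L _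
    intro n hn
    obtain ⟨a, _, rfl⟩ := Finset.mem_image.1 hn
    exact Finset.mem_range.2 (ZMod.val_lt a)
  have h3 : ∑ n ∈ range L, absSinZ L (2 * (n : ℤ) - s.val) =
      ∑ n ∈ range L, |Real.sin (2 * Real.pi * n / L - Real.pi * s.val / L)| := by
    refine Finset.sum_congr rfl fun n _ => ?_
    rw [absSinZ]
    congr 2
    push_cast
    ring
  rw [h1]
  refine h2.trans ?_
  rw [h3]
  rcases Nat.lt_or_ge L 2 with hlt | hge
  · have hL1 : L = 1 := by omega
    calc ∑ n ∈ range L, |Real.sin (2 * Real.pi * n / L - Real.pi * s.val / L)|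
        ≤ ∑ _n ∈ range L, (1 : ℝ) := Finset.sum_le_sum fun n _ => Real.abs_sin_le_one _
      _ = 1 := by rw [hL1]; simp
      _ ≤ 2 * L / Real.pi + 2 := by
          have : 0 ≤ 2 * (L : ℝ) / Real.pi := by positivity
          linarith
  · have hW := sum_abs_sin_mul_sin_le L hL (Real.pi * s.val / L)
    have hcsc := one_le_mul_sin_pi_div L hge
    have hlt : Real.pi / L < Real.pi := by
      refine div_lt_self hpi ?_
      exact_mod_cast (lt_of_lt_of_le (by norm_num) hge : 1 < L)
    have hsin : 0 < Real.sin (Real.pi / L) := Real.sin_pos_of_pos_of_lt_pi (by positivity) hlt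
    have hB : (∑ n ∈ range L, |Real.sin (2 * Real.pi * n / L - Real.pi * s.val / L)|) *
        Real.sin (Real.pi / L) ≤ (2 * L / Real.pi + 2) * Real.sin (Real.pi / L) := by
      have : (2 * L / Real.pi + 2) * Real.sin (Real.pi / L) =
          2 * (((L : ℝ) / Real.pi + 1) * Real.sin (Real.pi / L)) := by ring
      rw [this]
      linarith
    exact le_of_mul_le_mul_right hB hsin

/-- **`Φ_L ≤ 8L²/π² + 8L/π` for every `L ≥ 1`** (both parities). [folklore] -/
theorem sum_abs_dWaveGap_le_uniform :
    ∑ k : TorusSite 2 L, |dWaveGap k| ≤ 8 * (L : ℝ) ^ 2 / Real.pi ^ 2 + 8 * L / Real.pi := by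
  have hpi := Real.pi_pos
  have h1 : ∑ k : TorusSite 2 L, |dWaveGap k| =
      ∑ p : ZMod L × ZMod L, 2 * absSinZMod (p.1 + p.2) * absSinZMod (p.1 - p.2) := by
    refine Fintype.sum_equiv (finTwoArrowEquiv (ZMod L)) _ _ fun k => ?_
    rw [abs_dWaveGap_eq]
    rfl
  have h3 : ∀ a : ZMod L, ∑ b : ZMod L, 2 * absSinZMod (a + b) * absSinZMod (a - b) =
      ∑ s : ZMod L, 2 * absSinZMod s * absSinZMod (2 * a - s) := by
    intro a
    refine Fintype.sum_equiv (Equiv.addLeft a) _ _ fun b => ?_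
    simp only [Equiv.coe_addLeft]
    congr 2
    ring
  have hM : ∀ s : ZMod L, 2 * absSinZMod s * ∑ a : ZMod L, absSinZMod (2 * a - s) ≤
      2 * absSinZMod s * (2 * L / Real.pi + 2) := fun s =>
    mul_le_mul_of_nonneg_left (sum_absSinZMod_two_mul_sub_le s)
      (mul_nonneg zero_le_two (absSinZMod_nonneg s))
  have hS := sum_absSinZMod_le (L := L)
  have hS0 : 0 ≤ ∑ s : ZMod L, absSinZMod s := Finset.sum_nonneg fun s _ => absSinZMod_nonneg s
  calc ∑ k : TorusSite 2 L, |dWaveGap k|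
      = ∑ a : ZMod L, ∑ b : ZMod L, 2 * absSinZMod (a + b) * absSinZMod (a - b) := by
        rw [h1, Fintype.sum_prod_type]
    _ = ∑ a : ZMod L, ∑ s : ZMod L, 2 * absSinZMod s * absSinZMod (2 * a - s) :=
        Finset.sum_congr rfl fun a _ => h3 a
    _ = ∑ s : ZMod L, 2 * absSinZMod s * ∑ a : ZMod L, absSinZMod (2 * a - s) := by
        rw [Finset.sum_comm]
        refine Finset.sum_congr rfl fun s _ => ?_
        rw [Finset.mul_sum]
    _ ≤ ∑ s : ZMod L, 2 * absSinZMod s * (2 * L / Real.pi + 2) := Finset.sum_le_sum fun s _ => hM s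
    _ = 2 * (2 * L / Real.pi + 2) * ∑ s : ZMod L, absSinZMod s := by
        rw [Finset.mul_sum]
        refine Finset.sum_congr rfl fun s _ => ?_
        ring
    _ ≤ 2 * (2 * L / Real.pi + 2) * (2 * L / Real.pi) := by
        gcongr
    _ = 8 * (L : ℝ) ^ 2 / Real.pi ^ 2 + 8 * L / Real.pi := by
        field_simp; ring

end Summit.HubbardSuperconductivity.HubbardLadder
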